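import Literature.MathematicalPhysics.QuantumLattice.FinDimSpectrumProofs
import HarnessLib

/-!
# The constrained Boltzmann weight of a commuting projection: `⟨P⟩_β ≤ tr P · e^{-β(e - E)}`
# (Fröhlich–Lieb 1978, §I.E (1.45)–(1.47) and §III (3.1)–(3.7), the "classical" case `R₋ = 0`)

Topic `MathematicalPhysics/QuantumLattice`. The input the Peierls–chessboard chain
(`PeierlsChessboardTorusBound.peierls_chessboard_twoPoint_le`) needs is a bound
`⟨P_Λ⟩_β ≤ κ^{|Λ|}` on the expectation of the universal projection `P_Λ` (FL (1.45):
`R_Λ(β) = ⟨P_Λ⟩`). Fröhlich–Lieb split `R_Λ = R₋ + R₊` along the spectrum of `H` ((1.46), (3.1));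
when `P_Λ` COMMUTES with `H` ("classical" models (1), (2), (6): "`R₋(β,Δ) = 0` for sufficiently
small `Δ`. To show this we first estimate the minimum `ℰ(P_Λ)` of the Hamilton function `H_Λ`
restricted to the configurations `{S : S ∈ P_Λ}`", (3.4)–(3.7)) the whole estimate is elementary
and is proved here in operator form, for any finite-dimensional Hermitian `H` and any orthogonal
projection `P` commuting with it:

* `trace_mul_gibbsWeight_re_le` — if every vector of `range P` has energy `≥ e`
  (`e · ‖v‖² ≤ Re⟨v, Hv⟩` whenever `Pv = v`), then `Re tr(P e^{-βH}) ≤ Re tr P · e^{-βe}`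
  (`β ≥ 0`);
* `exp_neg_mul_le_partitionFn_re` — `e^{-βE} ≤ Z(β)` for every `E ≥ E₀(H)` (`β ≥ 0`);
* **`gibbsState_re_le_trace_mul_exp`** — hence `Re⟨P⟩_{β,H} ≤ Re tr P · e^{-β(e - E)}`: the
  constrained partition function is controlled by ONE energy gap `e - E` between a lower bound on
  the energies of the constrained sector and an upper bound on the ground-state energy (a
  variational energy `E = Re⟨φ, Hφ⟩` will do, `gibbsState_re_le_trace_mul_exp_rayleigh`).

For the quantum models (`[P_Λ, H] ≠ 0`) this is false and FL need §III.A (exponential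
localization, Thm. 3.1) — not here. No named facts; no sorries.

## References

* J. Fröhlich, E. H. Lieb, *Phase transitions in anisotropic lattice spin systems*, Comm. Math.
  Phys. **60** (1978) 233–267, §I.E eqs. (1.45)–(1.53), §III eqs. (3.1)–(3.7). [FrohlichLieb1978]
* H. Tasaki, *Physics and Mathematics of Quantum Many-Body Systems* (2020), App. A (Gibbs states
  of finite systems). [Tasaki2020]
-/

noncomputable section

open Matrix Finset
open scoped Matrix.Norms.L2Operator ComplexOrder MatrixOrder InnerProductSpace BigOperators

namespace Matrix

variable {n : Type*} [Fintype n] [DecidableEq n]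

omit [DecidableEq n] in
/-- `star v ⬝ᵥ v` is the real number `Σ |vᵢ|² ≥ 0`. [folklore] -/
private theorem cbw_star_dotProduct_self (v : n → ℂ) :
    star v ⬝ᵥ v = ((∑ i, Complex.normSq (v i) : ℝ) : ℂ) := by
  rw [dotProduct, Complex.ofReal_sum]
  refine sum_congr rfl fun i _ => ?_
  rw [Pi.star_apply, Complex.star_def, Complex.normSq_eq_conj_mul_self]

omit [DecidableEq n] in
/-- For an orthogonal projection, `star u ⬝ᵥ (P u) = ‖P u‖²`. [folklore] -/
private theorem cbw_star_dotProduct_proj {P : Matrix n n ℂ} (hP : P.IsHermitian) (hP2 : P * P = P)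
    (u : n → ℂ) : star u ⬝ᵥ (P *ᵥ u) = star (P *ᵥ u) ⬝ᵥ (P *ᵥ u) := by
  conv_lhs => rw [← hP2, ← mulVec_mulVec]
  rw [dotProduct_mulVec, star_mulVec, hP.eq]

/-- **The constrained Boltzmann weight (FL (3.4)–(3.7), operator form).** Let `H` be Hermitian,
`P` an orthogonal projection (`P = Pᴴ = P²`) commuting with `H`, `β ≥ 0`, and suppose every vector
of the range of `P` has energy at least `e`: `e · ‖v‖² ≤ Re⟨v, Hv⟩` whenever `Pv = v`. Then
`Re tr(P e^{-βH}) ≤ Re tr P · e^{-βe}` (expand in an eigenbasis of `H`: `P uᵢ` is again a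
`λᵢ`-eigenvector in `range P`, so `‖P uᵢ‖² ≠ 0` forces `λᵢ ≥ e`).
[cite: FrohlichLieb1978, eqs. (1.45)–(1.47), (3.4)–(3.7)] -/
theorem trace_mul_gibbsWeight_re_le {H P : Matrix n n ℂ} (hH : H.IsHermitian) (hP : P.IsHermitian)
    (hP2 : P * P = P) (hcomm : P * H = H * P) {β : ℝ} (hβ : 0 ≤ β) {e : ℝ}
    (he : ∀ v : n → ℂ, P *ᵥ v = v → e * (star v ⬝ᵥ v).re ≤ (star v ⬝ᵥ H *ᵥ v).re) :
    ((P * gibbsWeight β H).trace).re ≤ (P.trace).re * Real.exp (-(β * e)) := by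
  set U : Matrix n n ℂ := (hH.eigenvectorUnitary : Matrix n n ℂ) with hU
  have hUU : U * star U = 1 := Unitary.mul_star_self_of_mem hH.eigenvectorUnitary.prop
  -- `e^{-βH} = U diag(e^{-βλ}) U⋆`
  have hW : gibbsWeight β H =
      U * diagonal (fun i => (Real.exp (-(β * hH.eigenvalues i)) : ℂ)) * star U := by
    have hs : IsSelfAdjoint H := hH.isSelfAdjoint
    have hsmul : (-(β : ℂ) • H : Matrix n n ℂ) = (-β : ℝ) • H := by
      ext i j
      simp [Matrix.smul_apply, Complex.real_smul]
    have h1 : gibbsWeight β H = cfc (fun x : ℝ => Real.exp ((-β) • x)) H := by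
      rw [gibbsWeight, hsmul, cfc_comp_smul (-β) Real.exp H, CFC.real_exp_eq_normedSpace_exp]
    rw [h1, hH.cfc_eq, IsHermitian.cfc, Unitary.conjStarAlgAut_apply]
    simp only [smul_eq_mul, neg_mul]
    rfl
  -- the columns of `U` are eigenvectors
  have hcol : ∀ j, H *ᵥ (fun i => U i j) = ((hH.eigenvalues j : ℝ) : ℂ) • (fun i => U i j) := by
    intro j
    have h : (fun i => U i j) = ⇑(hH.eigenvectorBasis j) :=
      funext fun i => IsHermitian.eigenvectorUnitary_apply hH i j
    rw [h, hH.mulVec_eigenvectorBasis j, RCLike.real_smul_eq_coe_smul (K := ℂ)]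
    rfl
  -- `c j = ⟨u_j, P u_j⟩ = ‖P u_j‖²`
  set c : n → ℂ := fun j => (star U * P * U) j j with hc
  have hcj0 : ∀ j, c j = star (fun i => U i j) ⬝ᵥ (P *ᵥ fun i => U i j) := by
    intro j
    show (star U * P * U) j j = _
    rw [Matrix.mul_assoc]
    simp only [mul_apply, star_apply, mulVec, dotProduct, Pi.star_apply]
  have hcj : ∀ j, c j = star (P *ᵥ fun i => U i j) ⬝ᵥ (P *ᵥ fun i => U i j) := fun j => by
    rw [hcj0, cbw_star_dotProduct_proj hP hP2]
  have hcreal : ∀ j, c j = ((∑ i, Complex.normSq ((P *ᵥ fun k => U k j) i) : ℝ) : ℂ) := fun j => by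
    rw [hcj, cbw_star_dotProduct_self]
  have hcnn : ∀ j, 0 ≤ (c j).re := fun j => by
    rw [hcreal, Complex.ofReal_re]; exact sum_nonneg fun i _ => Complex.normSq_nonneg _
  -- energy: `λ_j < e` forces `‖P u_j‖² = 0`
  have hgap : ∀ j, (c j).re ≠ 0 → e ≤ hH.eigenvalues j := by
    intro j hj
    set w : n → ℂ := P *ᵥ fun i => U i j with hw
    have hPw : P *ᵥ w = w := by rw [hw, mulVec_mulVec, hP2]
    have hHw : H *ᵥ w = ((hH.eigenvalues j : ℝ) : ℂ) • w := by
      rw [hw, mulVec_mulVec, ← hcomm, ← mulVec_mulVec, hcol, mulVec_smul]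
    have h1 := he w hPw
    rw [hHw, dotProduct_smul, smul_eq_mul, Complex.re_ofReal_mul] at h1
    have hpos : 0 < (star w ⬝ᵥ w).re := by
      have : (star w ⬝ᵥ w).re = (c j).re := by rw [hcj]
      rw [this]
      exact lt_of_le_of_ne (hcnn j) (Ne.symm hj)
    exact le_of_mul_le_mul_right h1 hpos
  -- expand the trace
  have htr : (P * gibbsWeight β H).trace =
      ∑ j, c j * (Real.exp (-(β * hH.eigenvalues j)) : ℂ) := by
    rw [hW]
    have hassoc : P * (U * diagonal (fun i => (Real.exp (-(β * hH.eigenvalues i)) : ℂ)) * star U) =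
        P * U * diagonal (fun i => (Real.exp (-(β * hH.eigenvalues i)) : ℂ)) * star U := by
      simp only [Matrix.mul_assoc]
    rw [hassoc, trace_mul_comm, ← Matrix.mul_assoc, ← Matrix.mul_assoc]
    simp only [trace, diag_apply, mul_diagonal, hc]
  have htrP : (P.trace).re = ∑ j, (c j).re := by
    have : P.trace = (star U * P * U).trace := by
      rw [Matrix.mul_assoc, trace_mul_comm, Matrix.mul_assoc, hUU, Matrix.mul_one]
    rw [this, trace]
    simp only [diag_apply, Complex.re_sum, hc]
  rw [htr, Complex.re_sum, htrP, sum_mul]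
  refine sum_le_sum fun j _ => ?_
  rw [Complex.re_mul_ofReal]
  by_cases hj : (c j).re = 0
  · rw [hj, zero_mul, zero_mul]
  · refine mul_le_mul_of_nonneg_left (Real.exp_le_exp.2 ?_) (hcnn j)
    have := hgap j hj
    nlinarith

/-- **`e^{-βE} ≤ Z(β)` for every `E ≥ E₀(H)`** (`β ≥ 0`): keep the ground-state term of
`Z = Σᵢ e^{-βλᵢ}`. [cite: FrohlichLieb1978, eq. (1.47)] -/
theorem exp_neg_mul_le_partitionFn_re {H : Matrix n n ℂ} (hH : H.IsHermitian) [Nonempty n]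
    {β : ℝ} (hβ : 0 ≤ β) {E : ℝ} (hE : H.groundEnergy ≤ E) :
    Real.exp (-(β * E)) ≤ (partitionFn β H).re := by
  rw [partitionFn_eq_sum_exp β hH, Complex.re_sum]
  simp only [Complex.ofReal_re]
  obtain ⟨i₀, hi₀⟩ : ∃ i, hH.eigenvalues i = H.groundEnergy := by
    rw [Matrix.groundEnergy_eq_iInf_eigenvalues_holds hH]
    exact exists_eq_ciInf_of_finite
  calc Real.exp (-(β * E)) ≤ Real.exp (-β * hH.eigenvalues i₀) := by
        rw [Real.exp_le_exp, hi₀]; nlinarith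
    _ ≤ ∑ i, Real.exp (-β * hH.eigenvalues i) :=
        single_le_sum (f := fun i => Real.exp (-β * hH.eigenvalues i))
          (fun i _ => (Real.exp_pos _).le) (mem_univ i₀)

/-- **The constrained Boltzmann weight bound for the Gibbs state**: under the hypotheses of
`trace_mul_gibbsWeight_re_le` and `E ≥ E₀(H)`,
`Re⟨P⟩_{β,H} ≤ Re tr P · e^{-β(e - E)}` — FL's `R_Λ(β) = ⟨P_Λ⟩ ≤ exp[-β(ℰ(P_Λ) - e₀|Λ|)]·tr P_Λ` in
the commuting case, the `κ^{|Λ|}` input of the Peierls–chessboard argument.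
[cite: FrohlichLieb1978, eqs. (1.45)–(1.47), (3.4)–(3.7)] -/
theorem gibbsState_re_le_trace_mul_exp {H P : Matrix n n ℂ} (hH : H.IsHermitian) [Nonempty n]
    (hP : P.IsHermitian) (hP2 : P * P = P) (hcomm : P * H = H * P) {β : ℝ} (hβ : 0 ≤ β) {e E : ℝ}
    (he : ∀ v : n → ℂ, P *ᵥ v = v → e * (star v ⬝ᵥ v).re ≤ (star v ⬝ᵥ H *ᵥ v).re)
    (hE : H.groundEnergy ≤ E) :
    (gibbsState β H P).re ≤ (P.trace).re * Real.exp (-(β * (e - E))) := by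
  have hZpos : 0 < partitionFn β H := partitionFn_pos β hH
  obtain ⟨hZre, hZim⟩ := Complex.pos_iff.1 hZpos
  have hZ : partitionFn β H = ((partitionFn β H).re : ℂ) :=
    Complex.ext (by simp) (by rw [Complex.ofReal_im]; exact hZim.symm)
  have h1 := trace_mul_gibbsWeight_re_le hH hP hP2 hcomm hβ he
  have h2 := exp_neg_mul_le_partitionFn_re hH hβ hE
  have htrP : 0 ≤ (P.trace).re := by
    have hpsd : P.PosSemidef := by
      have := Matrix.posSemidef_conjTranspose_mul_self P
      rwa [hP.eq, hP2] at this
    exact (Complex.nonneg_iff.1 hpsd.trace_nonneg).1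
  rw [gibbsState_apply, trace_mul_comm, hZ, ← Complex.ofReal_inv, Complex.re_ofReal_mul]
  rw [inv_mul_le_iff₀ hZre]
  calc ((P * gibbsWeight β H).trace).re ≤ (P.trace).re * Real.exp (-(β * e)) := h1
    _ = Real.exp (-(β * E)) * ((P.trace).re * Real.exp (-(β * (e - E)))) := by
        rw [mul_left_comm, ← Real.exp_add]; ring_nf
    _ ≤ (partitionFn β H).re * ((P.trace).re * Real.exp (-(β * (e - E)))) :=
        mul_le_mul_of_nonneg_right h2 (mul_nonneg htrP (Real.exp_pos _).le)

/-- The variational form: any vector `φ ≠ 0` gives `E₀(H) ≤ Re⟨φ,Hφ⟩/‖φ‖²`, so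
`Re⟨P⟩_{β,H} ≤ Re tr P · e^{-β(e - Re⟨φ,Hφ⟩/‖φ‖²)}`. [cite: FrohlichLieb1978, eqs. (1.45)–(1.47)] -/
theorem gibbsState_re_le_trace_mul_exp_rayleigh {H P : Matrix n n ℂ} (hH : H.IsHermitian)
    [Nonempty n] (hP : P.IsHermitian) (hP2 : P * P = P) (hcomm : P * H = H * P) {β : ℝ}
    (hβ : 0 ≤ β) {e : ℝ}
    (he : ∀ v : n → ℂ, P *ᵥ v = v → e * (star v ⬝ᵥ v).re ≤ (star v ⬝ᵥ H *ᵥ v).re)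
    {φ : n → ℂ} (hφ : star φ ⬝ᵥ φ = 1) :
    (gibbsState β H P).re ≤ (P.trace).re * Real.exp (-(β * (e - (star φ ⬝ᵥ H *ᵥ φ).re))) :=
  gibbsState_re_le_trace_mul_exp hH hP hP2 hcomm hβ he
    (Matrix.groundEnergy_le_rayleigh_holds hH φ hφ)

/-! ### The spectral split `R_Λ = R₋ + R₊` (FL (1.46)–(1.53), (3.35)) -/

/-- **The spectral split of the constrained Boltzmann weight (FL (1.46)–(1.49), (1.52)–(1.53),
(3.35)).** Let `H` be Hermitian with orthonormal eigenbasis `φᵢ`, `H φᵢ = eᵢ φᵢ`, let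
`0 ≤ P ≤ 1`, `β ≥ 0`, and suppose the overlaps `Cᵢ = ⟨φᵢ, P φᵢ⟩` of the LOW-LYING eigenvectors
(`eᵢ ≤ E`) are at most `c ≥ 0`. Then
`Re tr(P e^{-βH}) ≤ c · Z(β) + tr(1) · e^{-βE}`: `tr(P e^{-βH}) = Σᵢ Cᵢ e^{-βeᵢ}` with
`0 ≤ Cᵢ ≤ 1`; the terms with `eᵢ ≤ E` give `R₋ ≤ c·Z` ((1.52), (3.35)), the others
`R₊ ≤ tr(1) e^{-βE}` ((1.49)).
[cite: FrohlichLieb1978, eqs. (1.46)–(1.49), (1.52)–(1.53), (3.35)] -/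
theorem trace_mul_gibbsWeight_re_le_split {H P : Matrix n n ℂ} (hH : H.IsHermitian)
    (hP : P.PosSemidef) (hP1 : (1 - P).PosSemidef) {β : ℝ} (hβ : 0 ≤ β) {E c : ℝ} (hc : 0 ≤ c)
    (hlow : ∀ i, hH.eigenvalues i ≤ E →
      (star (⇑(hH.eigenvectorBasis i) : n → ℂ) ⬝ᵥ P *ᵥ ⇑(hH.eigenvectorBasis i)).re ≤ c) :
    ((P * gibbsWeight β H).trace).re ≤
      c * (partitionFn β H).re + Fintype.card n * Real.exp (-(β * E)) := by
  set U : Matrix n n ℂ := (hH.eigenvectorUnitary : Matrix n n ℂ) with hU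
  have hUU' : star U * U = 1 := Unitary.star_mul_self_of_mem hH.eigenvectorUnitary.prop
  -- `e^{-βH} = U diag(e^{-βλ}) U⋆`
  have hW : gibbsWeight β H =
      U * diagonal (fun i => (Real.exp (-(β * hH.eigenvalues i)) : ℂ)) * star U := by
    have hs : IsSelfAdjoint H := hH.isSelfAdjoint
    have hsmul : (-(β : ℂ) • H : Matrix n n ℂ) = (-β : ℝ) • H := by
      ext i j
      simp [Matrix.smul_apply, Complex.real_smul]
    have h1 : gibbsWeight β H = cfc (fun x : ℝ => Real.exp ((-β) • x)) H := by
      rw [gibbsWeight, hsmul, cfc_comp_smul (-β) Real.exp H, CFC.real_exp_eq_normedSpace_exp]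
    rw [h1, hH.cfc_eq, IsHermitian.cfc, Unitary.conjStarAlgAut_apply]
    simp only [smul_eq_mul, neg_mul]
    rfl
  -- the columns of `U` are the eigenvectors `φ_j`
  have hcolb : ∀ j, (fun i => U i j) = ⇑(hH.eigenvectorBasis j) :=
    fun j => funext fun i => IsHermitian.eigenvectorUnitary_apply hH i j
  -- `c j = ⟨φ_j, P φ_j⟩ ∈ [0, 1]`
  set cj : n → ℂ := fun j => (star U * P * U) j j with hc'
  have hcj : ∀ j, cj j = star (fun i => U i j) ⬝ᵥ (P *ᵥ fun i => U i j) := by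
    intro j
    show (star U * P * U) j j = _
    rw [Matrix.mul_assoc]
    simp only [mul_apply, star_apply, mulVec, dotProduct, Pi.star_apply]
  have hnorm : ∀ j, star (fun i => U i j) ⬝ᵥ (fun i => U i j) = 1 := by
    intro j
    have := congrFun (congrFun hUU' j) j
    rw [Matrix.one_apply_eq] at this
    rw [← this]
    simp only [mul_apply, star_apply, dotProduct, Pi.star_apply]
  have hcnn : ∀ j, 0 ≤ (cj j).re := fun j => by
    rw [hcj]; exact (Complex.nonneg_iff.1 (hP.dotProduct_mulVec_nonneg _)).1
  have hc1 : ∀ j, (cj j).re ≤ 1 := fun j => by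
    have h := (Complex.nonneg_iff.1 (hP1.dotProduct_mulVec_nonneg (fun i => U i j))).1
    rw [sub_mulVec, one_mulVec, dotProduct_sub, Complex.sub_re, hnorm, Complex.one_re, ← hcj] at h
    linarith
  -- expand the trace
  have htr : (P * gibbsWeight β H).trace =
      ∑ j, cj j * (Real.exp (-(β * hH.eigenvalues j)) : ℂ) := by
    rw [hW]
    have hassoc : P * (U * diagonal (fun i => (Real.exp (-(β * hH.eigenvalues i)) : ℂ)) * star U) =
        P * U * diagonal (fun i => (Real.exp (-(β * hH.eigenvalues i)) : ℂ)) * star U := by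
      simp only [Matrix.mul_assoc]
    rw [hassoc, trace_mul_comm, ← Matrix.mul_assoc, ← Matrix.mul_assoc]
    simp only [trace, diag_apply, mul_diagonal, hc']
  have hZ : (partitionFn β H).re = ∑ j, Real.exp (-(β * hH.eigenvalues j)) := by
    rw [partitionFn_eq_sum_exp β hH, Complex.re_sum]
    exact sum_congr rfl fun j _ => by rw [Complex.ofReal_re, neg_mul]
  rw [htr, Complex.re_sum, hZ, mul_sum]
  -- termwise: `C_j e^{-βλ_j} ≤ c e^{-βλ_j} + e^{-βE}`
  have hterm : ∀ j, (cj j * (Real.exp (-(β * hH.eigenvalues j)) : ℂ)).re ≤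
      c * Real.exp (-(β * hH.eigenvalues j)) + Real.exp (-(β * E)) := by
    intro j
    rw [Complex.re_mul_ofReal]
    by_cases hj : hH.eigenvalues j ≤ E
    · have h1 : (cj j).re ≤ c := by rw [hcj, hcolb]; exact hlow j hj
      nlinarith [Real.exp_pos (-(β * hH.eigenvalues j)), Real.exp_pos (-(β * E))]
    · have h2 : Real.exp (-(β * hH.eigenvalues j)) ≤ Real.exp (-(β * E)) :=
        Real.exp_le_exp.2 (by nlinarith [lt_of_not_ge hj])
      nlinarith [hcnn j, hc1 j, Real.exp_pos (-(β * hH.eigenvalues j))]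
  calc ∑ j, (cj j * (Real.exp (-(β * hH.eigenvalues j)) : ℂ)).re
      ≤ ∑ j, (c * Real.exp (-(β * hH.eigenvalues j)) + Real.exp (-(β * E))) :=
        sum_le_sum fun j _ => hterm j
    _ = ∑ j, c * Real.exp (-(β * hH.eigenvalues j)) + Fintype.card n * Real.exp (-(β * E)) := by
        rw [sum_add_distrib, sum_const, card_univ, nsmul_eq_mul]

/-- **`Re⟨P⟩_β ≤ max_{eᵢ ≤ E} Cᵢ + tr(1) e^{-βE}/Z(β)`** (FL (1.47)–(1.49) with (1.52), (3.35)): the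
Gibbs expectation of `0 ≤ P ≤ 1` is bounded by the largest low-lying overlap plus the Boltzmann
tail. [cite: FrohlichLieb1978, eqs. (1.46)–(1.49), (1.52)–(1.53), (3.35)] -/
theorem gibbsState_re_le_split {H P : Matrix n n ℂ} (hH : H.IsHermitian) [Nonempty n]
    (hP : P.PosSemidef) (hP1 : (1 - P).PosSemidef) {β : ℝ} (hβ : 0 ≤ β) {E c : ℝ} (hc : 0 ≤ c)
    (hlow : ∀ i, hH.eigenvalues i ≤ E →
      (star (⇑(hH.eigenvectorBasis i) : n → ℂ) ⬝ᵥ P *ᵥ ⇑(hH.eigenvectorBasis i)).re ≤ c) :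
    (gibbsState β H P).re ≤
      c + Fintype.card n * Real.exp (-(β * E)) / (partitionFn β H).re := by
  have hZpos : 0 < partitionFn β H := partitionFn_pos β hH
  obtain ⟨hZre, hZim⟩ := Complex.pos_iff.1 hZpos
  have hZ : partitionFn β H = ((partitionFn β H).re : ℂ) :=
    Complex.ext (by simp) (by rw [Complex.ofReal_im]; exact hZim.symm)
  have h1 := trace_mul_gibbsWeight_re_le_split hH hP hP1 hβ hc hlow
  have hg : (gibbsState β H P).re =
      ((partitionFn β H).re)⁻¹ * ((P * gibbsWeight β H).trace).re := by
    rw [gibbsState_apply, trace_mul_comm]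
    conv_lhs => rw [hZ]
    rw [← Complex.ofReal_inv, Complex.re_ofReal_mul]
  have hid : (partitionFn β H).re *
      (c + Fintype.card n * Real.exp (-(β * E)) / (partitionFn β H).re) =
      c * (partitionFn β H).re + Fintype.card n * Real.exp (-(β * E)) := by
    field_simp
  rw [hg, inv_mul_le_iff₀ hZre, hid]
  exact h1

/-- **FL's `R_Λ ≤ R₋ + R₊` with the crude tail `R₊ ≤ tr(1) e^{-βΔ}`**: if every eigenvector of
energy `≤ E` has overlap `≤ c` with `P` and `E₀(H) ≤ E - Δ`... stated with the gap above a
ground-energy bound `E' ≥ E₀(H)`: `Re⟨P⟩_β ≤ c + tr(1)·e^{-βΔ}` when the low window is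
`eᵢ ≤ E' + Δ` (`Z ≥ e^{-βE'}`). [cite: FrohlichLieb1978, eqs. (1.47)–(1.53), (3.1)–(3.3), (3.35)] -/
theorem gibbsState_re_le_split_gap {H P : Matrix n n ℂ} (hH : H.IsHermitian) [Nonempty n]
    (hP : P.PosSemidef) (hP1 : (1 - P).PosSemidef) {β : ℝ} (hβ : 0 ≤ β) {E' Δ c : ℝ}
    (hE' : H.groundEnergy ≤ E') (hc : 0 ≤ c)
    (hlow : ∀ i, hH.eigenvalues i ≤ E' + Δ →
      (star (⇑(hH.eigenvectorBasis i) : n → ℂ) ⬝ᵥ P *ᵥ ⇑(hH.eigenvectorBasis i)).re ≤ c) :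
    (gibbsState β H P).re ≤ c + Fintype.card n * Real.exp (-(β * Δ)) := by
  have hZre : 0 < (partitionFn β H).re := (Complex.pos_iff.1 (partitionFn_pos β hH)).1
  have h1 := gibbsState_re_le_split hH hP hP1 hβ hc hlow
  have h2 := exp_neg_mul_le_partitionFn_re hH hβ hE'
  refine h1.trans (add_le_add le_rfl ?_)
  rw [div_le_iff₀ hZre, mul_assoc]
  refine mul_le_mul_of_nonneg_left ?_ (Nat.cast_nonneg _)
  calc Real.exp (-(β * (E' + Δ))) = Real.exp (-(β * Δ)) * Real.exp (-(β * E')) := by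
        rw [← Real.exp_add]; ring_nf
    _ ≤ Real.exp (-(β * Δ)) * (partitionFn β H).re :=
        mul_le_mul_of_nonneg_left h2 (Real.exp_pos _).le

end Matrix

end
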